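import Literature.MathematicalPhysics.QuantumLattice.FermiRG.BGM2003SectorPropagators
import Literature.MathematicalPhysics.QuantumLattice.SectorSymbolMasterSmooth
import HarnessLib

/-!
# Benfatto–Giuliani–Mastropietro 2003, Lemma 2.1 [lm3.1] (3.22) — proof, part 1: the Fermi frame of a
general symmetric dispersion, the anisotropic chart down to scale zero, and the smooth shell bump

Topic `Literature/MathematicalPhysics/QuantumLattice/FermiRG`; theorem-and-construction companion (seat t3) of
the statement file `BGM2003SectorPropagators.lean` (F3c), whose CLOSED NAMED FACT
`BGM2003.lemma21_sectorPropagatorDecay` (BGM 2003 Lemma 2.1, the decay (3.22) of the single-scale sector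
propagator `g^{(h)}_ω` with all derivative orders, for the GENERAL class `DispersionHyp` of §1.2) is
discharged in the sequel files `BGM2003SectorPropagatorDecayMaster.lean` / `…DecayProof.lean`.  Nothing of
F3a/F3b/F3c/F3d is edited or restated; no new named fact is introduced (D-0026).

* G. Benfatto, A. Giuliani, V. Mastropietro, *Low temperature analysis of two-dimensional Fermi systems with
  symmetric Fermi surface*, Ann. Henri Poincaré 4 (2003) 137–193, arXiv:cond-mat/0207210
  [BenfattoGiulianiMastropietro2003]; §7.2 (p.27 L28–52 of the materialised TeX): «Lemma 2.1 can be proved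
  very easily in the case of an interaction with elliptic symmetry, by using simple integration by parts
  arguments. In order to get the proof in the general case, it is sufficient to find a change of variables,
  well defined on the support of `F_{h,ω}` …».

## The route (the paper's §7.2, in the form the tree PROVED for the Hubbard band at order zero)

The tree's chain `SectorPropagatorSupBound → SectorPropagatorFourier → SectorChartPoint → SectorSymbolMaster{,Box,
Smooth,Zero} → SectorPropagatorDecay.sectorPropagator_decay` proves BGM 2006 Lemma 2.2 (= BGM 2003 (3.22) at
`(n₀,n₁,n₂) = 0`) for the HUBBARD dispersion at `-4 < μ < -2 - √2`, by exhibiting the rescaled symbol as the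
value at `s = γ^{h/2} = 2^{-n}` of ONE function smooth in `(θ₀, s, t)` down to `s = 0` (Hadamard's lemma in the
scale parameter, `Analysis/Calculus/SlopeQuotient`), so that the `h`-uniform `C^N` symbol bounds follow by
compactness and the decay by `Analysis/Fourier/FourierDecayFromDerivBounds`.  This file redoes the
model-dependent first third of that chain for an ABSTRACT datum `(ε, μ, e₀, u)` satisfying F3b's
`BGM2003.DispersionHyp`:

* §1 the `e = 0` frame of F3b — `p⃗_F(θ) = fermiPoint u θ`, `n⃗(θ) = unitNormal u θ 0`, `τ⃗(θ) = unitTangent u θ 0`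
  ((3.21)/(A1.6)–(A1.7)): orthonormal and positively oriented, smooth in `θ`, `dp⃗_F/dθ = s'(θ) τ⃗(θ)`, and the
  tangency `∇ε(p⃗_F(θ))·τ⃗(θ) = 0` (differentiate `ε(p⃗_F(θ)) ≡ μ`, `DispersionHyp.level` at `e = 0`);
* §2 the polar description of the shell `ℬ = shell u e₀` (A1.1): `e ↦ u(θ,e)` is strictly increasing on
  `[-e₀, e₀]` (`∂_e u = (∇ε·e⃗_r)⁻¹ > 0`, (2.8b)), so `ℬ ∩ {ρ e⃗_r(θ)} = {u(θ,-e₀) ≤ ρ ≤ u(θ,e₀)}`, and — the one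
  place where (2.8b) is used OFF the Fermi curve — a radial margin: for some `δ > 0`, points within radial
  distance `δ` outside `ℬ` have `|ε - μ| > e₀` (uniform continuity of `∇ε·e⃗_r` on a compact set + the mean value
  theorem);
* §3 the smooth **shell bump** `χ` (`BGM2003.shellBump`): `χ = 1` on `ℬ`, `χ` smooth on `ℝ²`, and `χ(k⃗) ≠ 0`,
  `k⃗ ∉ ℬ ⟹ |ε(k⃗) - μ| > e₀` — this replaces the indicator of `ℬ` in F3c's `sectorCutoff` by a smooth factor
  WITHOUT changing the integrand (the shell profile `f_h` vanishes where they differ), exactly as the tree's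
  `zoneBump` does for the Hubbard band;
* §4 the anisotropic chart `k⃗(θ₀,a,b;s) = p⃗_F(θ₀) + s²a n⃗(θ₀) + s b τ⃗(θ₀)` (`BGM2003.chartPt`; (3.21a) with
  `k'₁ = γ^h a`, `k'₂ = γ^{h/2} b`), the rescaled dispersion `Ẽ` with `ε(k⃗) - μ = s² Ẽ` smooth down to `s = 0`
  (`BGM2003.rescaledEps`, second-order `slopeQuot`; uses §1's tangency), and the rescaled truncated relative
  angle `Ã` with `Θ = s Ã` (`BGM2003.rescaledAng`, via the tree's globally smooth `truncArg`).

Everything here is PROVED; the definitions are `chartPt`, `epsFun`, `rescaledEps`, `uFun`, `angFun`,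
`rescaledAng`, `radialSlope`, `shellBump` (technical constructions of the proof, cited to the step of the paper they serve).
-/

noncomputable section

open Real Set Complex Function Filter
open scoped Topology ContDiff
open Literature.Analysis.Calculus Literature.Analysis.SpecialFunctions

namespace Literature.MathematicalPhysics.QuantumLattice.FermiRG

/-! ### §0. Coordinates of `e⃗_r`, `e⃗_t` -/

/-- `e⃗_t(θ)₀ = -sin θ`. [folklore] -/
@[simp] private theorem tdir_apply_zero (θ : ℝ) : tdir θ 0 = -Real.sin θ := rfl

/-- `e⃗_t(θ)₁ = cos θ`. [folklore] -/
@[simp] private theorem tdir_apply_one (θ : ℝ) : tdir θ 1 = Real.cos θ := rfl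

/-- `k₁ + ik₂` of `ρ e⃗_r(θ)` is `ρ e^{iθ}`. [cite: BenfattoGiulianiMastropietro2003, §7.1 (A1.1) p.26 (L16–22)] -/
theorem momToComplex_smul_dir (ρ θ : ℝ) : momToComplex (ρ • dir θ) = (ρ : ℂ) * exp ((θ : ℂ) * I) := by
  apply Complex.ext
  · simp [Complex.exp_ofReal_mul_I_re]
  · simp [Complex.exp_ofReal_mul_I_im]

/-- `‖ρ e⃗_r(θ)‖ = ρ` for `ρ ≥ 0` (norm of `k₁ + ik₂`). [cite: BenfattoGiulianiMastropietro2003, §7.1 (A1.1) p.26 (L16–22)] -/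
theorem norm_momToComplex_smul_dir {ρ : ℝ} (hρ : 0 ≤ ρ) (θ : ℝ) : ‖momToComplex (ρ • dir θ)‖ = ρ := by
  rw [momToComplex_smul_dir, norm_mul, Complex.norm_exp_ofReal_mul_I, mul_one, Complex.norm_real,
    Real.norm_eq_abs, abs_of_nonneg hρ]

/-- The polar angle of `ρ e⃗_r(θ)`, `ρ > 0`, is `θ` up to a multiple of `2π`. [cite: BenfattoGiulianiMastropietro2003, §7.1 (A1.1) p.26 (L16–22)] -/
theorem polarAngle_smul_dir {ρ : ℝ} (hρ : 0 < ρ) (θ : ℝ) : ∃ m : ℤ, polarAngle (ρ • dir θ) = θ + 2 * π * m := by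
  rw [polarAngle, momToComplex_smul_dir, Complex.arg_real_mul _ hρ, Complex.arg_exp_mul_I]
  refine ⟨-toIocDiv (mul_pos two_pos Real.pi_pos) (-π) θ, ?_⟩
  rw [toIocMod]
  push_cast
  ring

namespace BGM2003

variable {ε : (Fin 2 → ℝ) → ℝ} {μ e₀ : ℝ} {u : ℝ → ℝ → ℝ}

/-! ### §1. The `e = 0` frame of a `DispersionHyp` datum -/

/-- `θ ↦ u(θ, e)` is smooth on `ℝ` for every fixed `|e| ≤ e₀` (F3b's `DispersionHyp.smooth_u`: `u` is `C^∞`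
on `𝕋¹ × (-e₁, e₁)`, `e₁ > e₀`). [cite: BenfattoGiulianiMastropietro2003, §1.2 item 1 p.4 (L97–105)] -/
theorem DispersionHyp.contDiff_radius (hD : DispersionHyp ε μ e₀ u) {e : ℝ} (he : |e| ≤ e₀) :
    ContDiff ℝ ∞ fun θ => u θ e := by
  obtain ⟨e₁, he₁, hU⟩ := hD.smooth_u
  have hmem : ∀ θ : ℝ, ((fun θ : ℝ => ((θ, e) : ℝ × ℝ)) θ) ∈ (univ : Set ℝ) ×ˢ Ioo (-e₁) e₁ := by
    intro θ
    refine ⟨mem_univ _, ?_, ?_⟩ <;> [linarith [(abs_le.1 he).1]; linarith [(abs_le.1 he).2]]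
  exact hU.comp_contDiff (contDiff_id.prodMk contDiff_const) hmem

/-- `e ↦ u(θ, e)` is differentiable at every `|e| < e₁`, in particular on `(-e₀, e₀)` and at `±e₀`'s
neighbourhoods: precisely, `ContDiffOn` on `Ioo (-e₀') e₀'` for some `e₀' > e₀`. [cite: BenfattoGiulianiMastropietro2003, §1.2 item 1 p.4 (L97–105)] -/
theorem DispersionHyp.exists_contDiffOn_radius_e (hD : DispersionHyp ε μ e₀ u) :
    ∃ e₁ : ℝ, e₀ < e₁ ∧ ∀ θ : ℝ, ContDiffOn ℝ ∞ (fun e => u θ e) (Ioo (-e₁) e₁) := by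
  obtain ⟨e₁, he₁, hU⟩ := hD.smooth_u
  refine ⟨e₁, he₁, fun θ => ?_⟩
  have hg : ContDiffOn ℝ ∞ (fun e : ℝ => ((θ, e) : ℝ × ℝ)) (Ioo (-e₁) e₁) :=
    (contDiff_const.prodMk contDiff_id).contDiffOn
  exact hU.comp hg fun e he => ⟨mem_univ _, he⟩

/-- `u(θ, e) > 0` on the shell, with a uniform lower bound (`DispersionHyp.u_pos`). [cite: BenfattoGiulianiMastropietro2003, §1.2 item 1 p.4 (L97–105)] -/
theorem DispersionHyp.radius_pos (hD : DispersionHyp ε μ e₀ u) (θ : ℝ) {e : ℝ} (he : |e| ≤ e₀) : 0 < u θ e := by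
  obtain ⟨c, hc, hcu⟩ := hD.u_pos
  exact hc.trans_le (hcu θ e he)

/-- `u'(θ) = ∂_θ u(θ,0)` is smooth. [cite: BenfattoGiulianiMastropietro2003, §7.1 (A1.6)–(A1.7) p.26 (L35–52)] -/
theorem DispersionHyp.contDiff_radiusDeriv (hD : DispersionHyp ε μ e₀ u) {e : ℝ} (he : |e| ≤ e₀) :
    ContDiff ℝ ∞ fun θ => radiusDeriv u θ e := by
  have h := (contDiff_infty_iff_deriv.mp (hD.contDiff_radius he)).2
  exact h

/-- `θ ↦ u(θ, 0)` has derivative `u'(θ) = radiusDeriv u θ 0`. [cite: BenfattoGiulianiMastropietro2003, §7.1 (A1.6)–(A1.7) p.26 (L35–52)] -/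
theorem DispersionHyp.hasDerivAt_radius (hD : DispersionHyp ε μ e₀ u) {e : ℝ} (he : |e| ≤ e₀) (θ : ℝ) :
    HasDerivAt (fun ϑ => u ϑ e) (radiusDeriv u θ e) θ :=
  ((hD.contDiff_radius he).differentiable (by simp)).differentiableAt.hasDerivAt

/-- `s'(θ) = √(u'² + u²) > 0`. [cite: BenfattoGiulianiMastropietro2003, §7.1 (A1.6) p.26 (L41)] -/
theorem DispersionHyp.speed_pos (hD : DispersionHyp ε μ e₀ u) (θ : ℝ) {e : ℝ} (he : |e| ≤ e₀) : 0 < speed u θ e := by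
  unfold speed
  have hu := hD.radius_pos θ he
  exact Real.sqrt_pos.2 (by positivity)

/-- `s'(θ)² = u'² + u²`. [cite: BenfattoGiulianiMastropietro2003, §7.1 (A1.6)–(A1.7) p.26 (L35–52)] -/
theorem speed_sq (u : ℝ → ℝ → ℝ) (θ e : ℝ) : speed u θ e ^ 2 = radiusDeriv u θ e ^ 2 + u θ e ^ 2 :=
  Real.sq_sqrt (by positivity)

/-- `s'(θ)` is smooth in `θ` (at `|e| ≤ e₀`). [cite: BenfattoGiulianiMastropietro2003, §7.1 (A1.6)–(A1.7) p.26 (L35–52)] -/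
theorem DispersionHyp.contDiff_speed (hD : DispersionHyp ε μ e₀ u) {e : ℝ} (he : |e| ≤ e₀) :
    ContDiff ℝ ∞ fun θ => speed u θ e := by
  unfold speed
  refine ContDiff.sqrt (((hD.contDiff_radiusDeriv he).pow 2).add ((hD.contDiff_radius he).pow 2)) fun θ => ?_
  have := hD.radius_pos θ he
  positivity

/-- Components of `n⃗(θ,e)`: `n₀ = (u cos θ + u' sin θ)/s'`. [cite: BenfattoGiulianiMastropietro2003, §7.1 (A1.7) p.26 (L45–50)] -/
theorem unitNormal_apply_zero (u : ℝ → ℝ → ℝ) (θ e : ℝ) :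
    unitNormal u θ e 0 = (speed u θ e)⁻¹ * (u θ e * Real.cos θ + radiusDeriv u θ e * Real.sin θ) := by
  simp [unitNormal, sub_eq_add_neg]

/-- Components of `n⃗(θ,e)`: `n₁ = (u sin θ - u' cos θ)/s'`. [cite: BenfattoGiulianiMastropietro2003, §7.1 (A1.7) p.26 (L45–50)] -/
theorem unitNormal_apply_one (u : ℝ → ℝ → ℝ) (θ e : ℝ) :
    unitNormal u θ e 1 = (speed u θ e)⁻¹ * (u θ e * Real.sin θ - radiusDeriv u θ e * Real.cos θ) := by
  simp [unitNormal]

/-- Components of `τ⃗(θ,e)`: `τ₀ = (u' cos θ - u sin θ)/s'`. [cite: BenfattoGiulianiMastropietro2003, §7.1 (A1.6) p.26 (L35–41)] -/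
theorem unitTangent_apply_zero (u : ℝ → ℝ → ℝ) (θ e : ℝ) :
    unitTangent u θ e 0 = (speed u θ e)⁻¹ * (radiusDeriv u θ e * Real.cos θ - u θ e * Real.sin θ) := by
  simp [unitTangent, sub_eq_add_neg]

/-- Components of `τ⃗(θ,e)`: `τ₁ = (u' sin θ + u cos θ)/s'`. [cite: BenfattoGiulianiMastropietro2003, §7.1 (A1.6) p.26 (L35–41)] -/
theorem unitTangent_apply_one (u : ℝ → ℝ → ℝ) (θ e : ℝ) :
    unitTangent u θ e 1 = (speed u θ e)⁻¹ * (radiusDeriv u θ e * Real.sin θ + u θ e * Real.cos θ) := by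
  simp [unitTangent]

/-- `τ⃗ = (-n₁, n₀)`: the frame is `n⃗` rotated by `+π/2`, first component. [cite: BenfattoGiulianiMastropietro2003, §7.1 (A1.6)–(A1.7) p.26 (L35–50)] -/
theorem unitTangent_apply_zero_eq (u : ℝ → ℝ → ℝ) (θ e : ℝ) : unitTangent u θ e 0 = -unitNormal u θ e 1 := by
  rw [unitTangent_apply_zero, unitNormal_apply_one]; ring

/-- `τ⃗ = (-n₁, n₀)`, second component. [cite: BenfattoGiulianiMastropietro2003, §7.1 (A1.6)–(A1.7) p.26 (L35–50)] -/
theorem unitTangent_apply_one_eq (u : ℝ → ℝ → ℝ) (θ e : ℝ) : unitTangent u θ e 1 = unitNormal u θ e 0 := by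
  rw [unitTangent_apply_one, unitNormal_apply_zero]; ring

/-- `‖n⃗‖² = 1`. [cite: BenfattoGiulianiMastropietro2003, §7.1 (A1.7) p.26 (L45–50)] -/
theorem DispersionHyp.unitNormal_normSq (hD : DispersionHyp ε μ e₀ u) (θ : ℝ) {e : ℝ} (he : |e| ≤ e₀) :
    unitNormal u θ e 0 ^ 2 + unitNormal u θ e 1 ^ 2 = 1 := by
  have hs := (hD.speed_pos θ he).ne'
  have hs2 := speed_sq u θ e
  have hcs := Real.cos_sq_add_sin_sq θ
  have key : (u θ e * Real.cos θ + radiusDeriv u θ e * Real.sin θ) ^ 2 +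
      (u θ e * Real.sin θ - radiusDeriv u θ e * Real.cos θ) ^ 2 = speed u θ e ^ 2 := by
    linear_combination (radiusDeriv u θ e ^ 2 + u θ e ^ 2) * hcs - hs2
  rw [unitNormal_apply_zero, unitNormal_apply_one, mul_pow, mul_pow, ← mul_add, key, inv_pow,
    inv_mul_cancel₀ (pow_ne_zero 2 hs)]

/-- `‖τ⃗‖² = 1`. [cite: BenfattoGiulianiMastropietro2003, §7.1 (A1.6) p.26 (L35–41)] -/
theorem DispersionHyp.unitTangent_normSq (hD : DispersionHyp ε μ e₀ u) (θ : ℝ) {e : ℝ} (he : |e| ≤ e₀) :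
    unitTangent u θ e 0 ^ 2 + unitTangent u θ e 1 ^ 2 = 1 := by
  rw [unitTangent_apply_zero_eq, unitTangent_apply_one_eq, neg_sq, add_comm]
  exact hD.unitNormal_normSq θ he

/-- `n⃗ · τ⃗ = 0`. [cite: BenfattoGiulianiMastropietro2003, §7.1 (A1.6)–(A1.7) p.26 (L35–50)] -/
theorem unitNormal_dot_unitTangent (u : ℝ → ℝ → ℝ) (θ e : ℝ) :
    unitNormal u θ e 0 * unitTangent u θ e 0 + unitNormal u θ e 1 * unitTangent u θ e 1 = 0 := by
  rw [unitTangent_apply_zero_eq, unitTangent_apply_one_eq]; ring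

/-- `n⃗ × τ⃗ = 1`: the frame `(n⃗, τ⃗)` is positively oriented. [cite: BenfattoGiulianiMastropietro2003, §7.1 (A1.6)–(A1.7) p.26 (L35–50)] -/
theorem DispersionHyp.unitNormal_cross_unitTangent (hD : DispersionHyp ε μ e₀ u) (θ : ℝ) {e : ℝ} (he : |e| ≤ e₀) :
    unitNormal u θ e 0 * unitTangent u θ e 1 - unitNormal u θ e 1 * unitTangent u θ e 0 = 1 := by
  rw [unitTangent_apply_zero_eq, unitTangent_apply_one_eq]
  have := hD.unitNormal_normSq θ he
  linear_combination this

/-- The components of `n⃗(θ) = n⃗(θ,0)` are smooth in `θ`. [cite: BenfattoGiulianiMastropietro2003, §7.1 (A1.6)–(A1.7) p.26 (L35–52)] -/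
theorem DispersionHyp.contDiff_unitNormal_apply (hD : DispersionHyp ε μ e₀ u) (i : Fin 2) :
    ContDiff ℝ ∞ fun θ => unitNormal u θ 0 i := by
  have he : |(0 : ℝ)| ≤ e₀ := by rw [abs_zero]; exact hD.e₀_pos.le
  have hinv : ContDiff ℝ ∞ fun θ => (speed u θ 0)⁻¹ :=
    (hD.contDiff_speed he).inv fun θ => (hD.speed_pos θ he).ne'
  have hu := hD.contDiff_radius he
  have hu' := hD.contDiff_radiusDeriv he
  fin_cases i
  · simp only [Fin.zero_eta, unitNormal_apply_zero]
    exact hinv.mul ((hu.mul Real.contDiff_cos).add (hu'.mul Real.contDiff_sin))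
  · simp only [Fin.mk_one, unitNormal_apply_one]
    exact hinv.mul ((hu.mul Real.contDiff_sin).sub (hu'.mul Real.contDiff_cos))

/-- The components of `τ⃗(θ) = τ⃗(θ,0)` are smooth in `θ`. [cite: BenfattoGiulianiMastropietro2003, §7.1 (A1.6)–(A1.7) p.26 (L35–52)] -/
theorem DispersionHyp.contDiff_unitTangent_apply (hD : DispersionHyp ε μ e₀ u) (i : Fin 2) :
    ContDiff ℝ ∞ fun θ => unitTangent u θ 0 i := by
  have he : |(0 : ℝ)| ≤ e₀ := by rw [abs_zero]; exact hD.e₀_pos.le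
  have hinv : ContDiff ℝ ∞ fun θ => (speed u θ 0)⁻¹ :=
    (hD.contDiff_speed he).inv fun θ => (hD.speed_pos θ he).ne'
  have hu := hD.contDiff_radius he
  have hu' := hD.contDiff_radiusDeriv he
  fin_cases i
  · simp only [Fin.zero_eta, unitTangent_apply_zero]
    exact hinv.mul ((hu'.mul Real.contDiff_cos).sub (hu.mul Real.contDiff_sin))
  · simp only [Fin.mk_one, unitTangent_apply_one]
    exact hinv.mul ((hu'.mul Real.contDiff_sin).add (hu.mul Real.contDiff_cos))

/-- Components of the Fermi point: `p⃗_F(θ)₀ = u(θ,0) cos θ`. [cite: BenfattoGiulianiMastropietro2003, §1.2 p.4 (L121–123)] -/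
@[simp] theorem fermiPoint_apply_zero (u : ℝ → ℝ → ℝ) (θ : ℝ) : fermiPoint u θ 0 = u θ 0 * Real.cos θ := by
  simp [fermiPoint, levelPoint]

/-- Components of the Fermi point: `p⃗_F(θ)₁ = u(θ,0) sin θ`. [cite: BenfattoGiulianiMastropietro2003, §1.2 p.4 (L121–123)] -/
@[simp] theorem fermiPoint_apply_one (u : ℝ → ℝ → ℝ) (θ : ℝ) : fermiPoint u θ 1 = u θ 0 * Real.sin θ := by
  simp [fermiPoint, levelPoint]

/-- The components of `p⃗_F(θ)` are smooth in `θ`. [cite: BenfattoGiulianiMastropietro2003, §7.1 (A1.6)–(A1.7) p.26 (L35–52)] -/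
theorem DispersionHyp.contDiff_fermiPoint_apply (hD : DispersionHyp ε μ e₀ u) (i : Fin 2) :
    ContDiff ℝ ∞ fun θ => fermiPoint u θ i := by
  have he : |(0 : ℝ)| ≤ e₀ := by rw [abs_zero]; exact hD.e₀_pos.le
  have hu := hD.contDiff_radius he
  fin_cases i
  · simp only [Fin.zero_eta, fermiPoint_apply_zero]; exact hu.mul Real.contDiff_cos
  · simp only [Fin.mk_one, fermiPoint_apply_one]; exact hu.mul Real.contDiff_sin

/-- **`dp⃗_F/dθ = s'(θ) τ⃗(θ)`** (the definition (3.21) of `τ⃗` as the normalised velocity), componentwise.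
[cite: BenfattoGiulianiMastropietro2003, §2.3 (3.21) p.8 (L27–32)] -/
theorem DispersionHyp.hasDerivAt_fermiPoint_apply (hD : DispersionHyp ε μ e₀ u) (θ : ℝ) (i : Fin 2) :
    HasDerivAt (fun ϑ => fermiPoint u ϑ i) (speed u θ 0 * unitTangent u θ 0 i) θ := by
  have he : |(0 : ℝ)| ≤ e₀ := by rw [abs_zero]; exact hD.e₀_pos.le
  have hu := hD.hasDerivAt_radius he θ
  have hs := hD.speed_pos θ he
  fin_cases i
  · have h := hu.mul (Real.hasDerivAt_cos θ)
    have heq : speed u θ 0 * unitTangent u θ 0 0 = radiusDeriv u θ 0 * Real.cos θ + u θ 0 * -Real.sin θ := by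
      rw [unitTangent_apply_zero]; field_simp; ring
    simp only [Fin.zero_eta, fermiPoint_apply_zero]
    rw [heq]; exact h
  · have h := hu.mul (Real.hasDerivAt_sin θ)
    have heq : speed u θ 0 * unitTangent u θ 0 1 = radiusDeriv u θ 0 * Real.sin θ + u θ 0 * Real.cos θ := by
      rw [unitTangent_apply_one]; field_simp
    simp only [Fin.mk_one, fermiPoint_apply_one]
    rw [heq]; exact h

/-- `dp⃗_F/dθ = s'(θ) τ⃗(θ)` as a vector-valued derivative. [cite: BenfattoGiulianiMastropietro2003, §2.3 (3.21) p.8 (L27–32)] -/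
theorem DispersionHyp.hasDerivAt_fermiPoint (hD : DispersionHyp ε μ e₀ u) (θ : ℝ) :
    HasDerivAt (fun ϑ => fermiPoint u ϑ) (speed u θ 0 • unitTangent u θ 0) θ := by
  rw [hasDerivAt_pi]
  intro i
  simpa [Pi.smul_apply, smul_eq_mul] using hD.hasDerivAt_fermiPoint_apply θ i

/-- **Tangency**: `∇ε(p⃗_F(θ))·τ⃗(θ) = 0` — differentiate `ε(p⃗_F(θ)) ≡ μ` (`DispersionHyp.level` at `e = 0`) and
divide by `s'(θ) > 0`. [cite: BenfattoGiulianiMastropietro2003, §1.2 item 1 p.4 (L97–105) and §2.3 (3.21) p.8 (L27–32)] -/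
theorem DispersionHyp.fderiv_fermiPoint_unitTangent (hD : DispersionHyp ε μ e₀ u) (θ : ℝ) :
    fderiv ℝ ε (fermiPoint u θ) (unitTangent u θ 0) = 0 := by
  have he : |(0 : ℝ)| ≤ e₀ := by rw [abs_zero]; exact hD.e₀_pos.le
  have hε : DifferentiableAt ℝ ε (fermiPoint u θ) := (hD.smooth_ε.differentiable (by simp)).differentiableAt
  have hcomp : HasDerivAt (fun ϑ => ε (fermiPoint u ϑ))
      (fderiv ℝ ε (fermiPoint u θ) (speed u θ 0 • unitTangent u θ 0)) θ :=
    hε.hasFDerivAt.comp_hasDerivAt θ (hD.hasDerivAt_fermiPoint θ)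
  have hconst : (fun ϑ => ε (fermiPoint u ϑ)) = fun _ => μ := by
    funext ϑ
    have := hD.level ϑ 0 he
    rw [add_zero] at this
    exact this
  rw [hconst] at hcomp
  have h0 := hcomp.unique (hasDerivAt_const θ μ)
  rw [map_smul, smul_eq_mul] at h0
  rcases mul_eq_zero.1 h0 with h | h
  · exact absurd h (hD.speed_pos θ he).ne'
  · exact h

/-! ### §2. The radial structure of the shell `ℬ` -/

/-- The radial derivative `∂_ρ ε(ρ e⃗_r(θ)) = ∇ε(ρ e⃗_r(θ))·e⃗_r(θ)` as a function of `(θ, ρ)`. [cite: BenfattoGiulianiMastropietro2003, §1.2 (2.8b) p.4 (L107–111)] -/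
def radialSlope (ε : (Fin 2 → ℝ) → ℝ) (θ ρ : ℝ) : ℝ := fderiv ℝ ε (ρ • dir θ) (dir θ)

/-- `ρ ↦ ε(ρ e⃗_r(θ))` has derivative `radialSlope ε θ ρ` (for `C¹` `ε`). [cite: BenfattoGiulianiMastropietro2003, §1.2 (2.8b) p.4 (L107–111)] -/
theorem hasDerivAt_eps_radial (hε : ContDiff ℝ ∞ ε) (θ ρ : ℝ) :
    HasDerivAt (fun r : ℝ => ε (r • dir θ)) (radialSlope ε θ ρ) ρ := by
  have h1 : HasDerivAt (fun r : ℝ => r • dir θ) (dir θ) ρ := by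
    simpa using (hasDerivAt_id ρ).smul_const (dir θ)
  have h2 := ((hε.differentiable (by simp)).differentiableAt (x := ρ • dir θ)).hasFDerivAt.comp_hasDerivAt ρ h1
  exact h2

/-- `(θ, ρ) ↦ radialSlope ε θ ρ` is continuous (for `C¹` `ε`). [cite: BenfattoGiulianiMastropietro2003, §1.2 (2.8b) p.4 (L107–111)] -/
theorem continuous_radialSlope (hε : ContDiff ℝ ∞ ε) : Continuous fun p : ℝ × ℝ => radialSlope ε p.1 p.2 := by
  unfold radialSlope
  have hdir : Continuous fun p : ℝ × ℝ => dir p.1 := by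
    refine continuous_pi fun i => ?_
    fin_cases i
    · simp only [Fin.zero_eta, Fin.isValue, dir_zero]
      exact Real.continuous_cos.comp' continuous_fst
    · simp only [Fin.mk_one, Fin.isValue, dir_one]
      exact Real.continuous_sin.comp' continuous_fst
  have hpt : Continuous fun p : ℝ × ℝ => p.2 • dir p.1 := continuous_snd.smul hdir
  exact ((hε.continuous_fderiv (by simp)).comp hpt).clm_apply hdir

/-- On the shell the radial derivative is pinched: `c₁ ≤ radialSlope ε θ (u(θ,e)) ≤ c₂` for `|e| ≤ e₀`
(`DispersionHyp.radial`, (2.8b)). [cite: BenfattoGiulianiMastropietro2003, §1.2 (2.8b) p.4 (L107–111)] -/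
theorem radialSlope_levelPoint (θ e : ℝ) : radialSlope ε θ (u θ e) = fderiv ℝ ε (levelPoint u θ e) (dir θ) := rfl

/-- **`e ↦ u(θ,e)` is strictly increasing on `[-e₀, e₀]`**: differentiating `ε(u(θ,e)e⃗_r(θ)) = μ + e` gives
`∂_e u · (∇ε·e⃗_r) = 1` with `∇ε·e⃗_r ≥ c₁ > 0`. [cite: BenfattoGiulianiMastropietro2003, §1.2 item 1 and (2.8b) p.4 (L97–111)] -/
theorem DispersionHyp.strictMonoOn_radius (hD : DispersionHyp ε μ e₀ u) (θ : ℝ) :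
    StrictMonoOn (fun e => u θ e) (Icc (-e₀) e₀) := by
  obtain ⟨e₁, he₁, hU⟩ := hD.exists_contDiffOn_radius_e
  obtain ⟨c₁, c₂, hc₁, -, hrad⟩ := hD.radial
  have hdiff : DifferentiableOn ℝ (fun e => u θ e) (Ioo (-e₁) e₁) := (hU θ).differentiableOn (by simp)
  have hsub : Icc (-e₀) e₀ ⊆ Ioo (-e₁) e₁ := fun e he => ⟨by linarith [he.1], by linarith [he.2]⟩
  refine strictMonoOn_of_deriv_pos (convex_Icc _ _) (hdiff.continuousOn.mono hsub) fun e he => ?_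
  rw [interior_Icc] at he
  -- at an interior point, `ε(u(θ,·) e⃗_r) = μ + ·` near `e`
  have hmemo : Ioo (-e₁) e₁ ∈ 𝓝 e := Ioo_mem_nhds (by linarith [he.1]) (by linarith [he.2])
  have hue : HasDerivAt (fun e => u θ e) (deriv (fun e => u θ e) e) e :=
    ((hdiff e ⟨by linarith [he.1], by linarith [he.2]⟩).differentiableAt hmemo).hasDerivAt
  have h1 : HasDerivAt (fun e' : ℝ => u θ e' • dir θ) (deriv (fun e => u θ e) e • dir θ) e := hue.smul_const _
  have hε : DifferentiableAt ℝ ε (u θ e • dir θ) := (hD.smooth_ε.differentiable (by simp)).differentiableAt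
  have h2 : HasDerivAt (fun e' : ℝ => ε (u θ e' • dir θ))
      (fderiv ℝ ε (u θ e • dir θ) (deriv (fun e => u θ e) e • dir θ)) e :=
    hε.hasFDerivAt.comp_hasDerivAt e h1
  rw [map_smul, smul_eq_mul] at h2
  -- the same function is `μ + e'` near `e`
  have heq : (fun e' : ℝ => ε (u θ e' • dir θ)) =ᶠ[𝓝 e] fun e' => μ + e' := by
    have : Ioo (-e₀) e₀ ∈ 𝓝 e := Ioo_mem_nhds he.1 he.2
    filter_upwards [this] with e' he'
    exact hD.level θ e' (abs_le.2 ⟨he'.1.le, he'.2.le⟩)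
  have h3 : HasDerivAt (fun e' : ℝ => ε (u θ e' • dir θ)) 1 e := by
    refine HasDerivAt.congr_of_eventuallyEq ?_ heq
    simpa using (hasDerivAt_id e).const_add μ
  have hprod : deriv (fun e => u θ e) e * fderiv ℝ ε (u θ e • dir θ) (dir θ) = 1 := h2.unique h3
  have hge : c₁ ≤ fderiv ℝ ε (u θ e • dir θ) (dir θ) := (hrad θ e (abs_le.2 ⟨he.1.le, he.2.le⟩)).1
  have hpos : 0 < fderiv ℝ ε (u θ e • dir θ) (dir θ) := hc₁.trans_le hge
  by_contra hle
  push Not at hle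
  have : deriv (fun e => u θ e) e * fderiv ℝ ε (u θ e • dir θ) (dir θ) ≤ 0 :=
    mul_nonpos_of_nonpos_of_nonneg hle hpos.le
  linarith

/-- `e ↦ u(θ,e)` is continuous on `[-e₀, e₀]`. [cite: BenfattoGiulianiMastropietro2003, §1.2 item 1 p.4 (L97–105)] -/
theorem DispersionHyp.continuousOn_radius (hD : DispersionHyp ε μ e₀ u) (θ : ℝ) :
    ContinuousOn (fun e => u θ e) (Icc (-e₀) e₀) := by
  obtain ⟨e₁, he₁, hU⟩ := hD.exists_contDiffOn_radius_e
  exact (hU θ).continuousOn.mono fun e he => ⟨by linarith [he.1], by linarith [he.2]⟩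

/-- A point of `ℬ` written as `u(θ,e)e⃗_r(θ)` has norm `u(θ,e)`. [cite: BenfattoGiulianiMastropietro2003, §7.1 (A1.1) p.26 (L16–22)] -/
theorem DispersionHyp.norm_momToComplex_levelPoint (hD : DispersionHyp ε μ e₀ u) (θ : ℝ) {e : ℝ} (he : |e| ≤ e₀) :
    ‖momToComplex (levelPoint u θ e)‖ = u θ e :=
  norm_momToComplex_smul_dir (hD.radius_pos θ he).le θ

/-- `u(θ(k⃗), e') = u(θ, e')` when `k⃗ = u(θ,e)e⃗_r(θ) ∈ ℬ` (the polar angle is `θ` mod `2π`, `u` is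
`2π`-periodic). [cite: BenfattoGiulianiMastropietro2003, §7.1 (A1.1) p.26 (L16–22)] -/
theorem DispersionHyp.radius_polarAngle_levelPoint (hD : DispersionHyp ε μ e₀ u) (θ : ℝ) {e : ℝ} (he : |e| ≤ e₀)
    (e' : ℝ) : u (polarAngle (levelPoint u θ e)) e' = u θ e' := by
  obtain ⟨m, hm⟩ := polarAngle_smul_dir (hD.radius_pos θ he) θ
  rw [levelPoint, hm, show θ + 2 * π * m = θ + m * (2 * π) by ring]
  exact (hD.periodic_u e').int_mul m θ

/-- **Radial description of `ℬ`, easy half**: if `k⃗ ∈ ℬ` then `u(θ(k⃗),-e₀) ≤ ‖k⃗‖ ≤ u(θ(k⃗),e₀)`.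
[cite: BenfattoGiulianiMastropietro2003, §7.1 (A1.1) p.26 (L16–22)] -/
theorem DispersionHyp.radius_le_norm_of_mem_shell (hD : DispersionHyp ε μ e₀ u) {k : Fin 2 → ℝ}
    (hk : k ∈ shell u e₀) :
    u (polarAngle k) (-e₀) ≤ ‖momToComplex k‖ ∧ ‖momToComplex k‖ ≤ u (polarAngle k) e₀ := by
  obtain ⟨θ, e, he, rfl⟩ := hk
  have he' := abs_le.1 he
  have h0 : |(-e₀ : ℝ)| ≤ e₀ := by rw [abs_neg, abs_of_pos hD.e₀_pos]
  have h1 : |(e₀ : ℝ)| ≤ e₀ := by rw [abs_of_pos hD.e₀_pos]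
  rw [hD.norm_momToComplex_levelPoint θ he, hD.radius_polarAngle_levelPoint θ he,
    hD.radius_polarAngle_levelPoint θ he]
  have hmono := (hD.strictMonoOn_radius θ).monotoneOn
  exact ⟨hmono ⟨le_rfl, by linarith [hD.e₀_pos]⟩ ⟨he'.1, he'.2⟩ he'.1,
    hmono ⟨he'.1, he'.2⟩ ⟨by linarith [hD.e₀_pos], le_rfl⟩ he'.2⟩

/-- **Radial description of `ℬ`, converse**: a momentum with `u(θ(k⃗),-e₀) ≤ ‖k⃗‖ ≤ u(θ(k⃗),e₀)` lies in `ℬ`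
(intermediate value theorem in `e`). [cite: BenfattoGiulianiMastropietro2003, §7.1 (A1.1) p.26 (L16–22)] -/
theorem DispersionHyp.mem_shell_of_radius_le_norm (hD : DispersionHyp ε μ e₀ u) {k : Fin 2 → ℝ}
    (h1 : u (polarAngle k) (-e₀) ≤ ‖momToComplex k‖) (h2 : ‖momToComplex k‖ ≤ u (polarAngle k) e₀) :
    k ∈ shell u e₀ := by
  have hivt := intermediate_value_Icc (by linarith [hD.e₀_pos] : (-e₀ : ℝ) ≤ e₀) (hD.continuousOn_radius (polarAngle k))
  obtain ⟨e, he, heq⟩ := hivt ⟨h1, h2⟩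
  simp only at heq
  refine ⟨polarAngle k, e, abs_le.2 ⟨he.1, he.2⟩, ?_⟩
  rw [levelPoint, heq]
  exact polar_repr k

/-- On `ℬ`, `|ε - μ| ≤ e₀`. [cite: BenfattoGiulianiMastropietro2003, §7.1 (A1.1) p.26 (L16–22)] -/
theorem DispersionHyp.abs_sub_le_of_mem_shell (hD : DispersionHyp ε μ e₀ u) {k : Fin 2 → ℝ} (hk : k ∈ shell u e₀) :
    |ε k - μ| ≤ e₀ := by
  obtain ⟨θ, e, he, rfl⟩ := hk
  rw [hD.level θ e he, add_sub_cancel_left]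
  exact he

/-- A compactness lemma: a continuous `ψ` on `ℝ²` exceeding `c` on `[a,b] × {0}` exceeds `c` on
`[a,b] × [0,δ]` for some `δ > 0`. [folklore] -/
private theorem exists_pos_forall_lt_of_continuous {ψ : ℝ × ℝ → ℝ} (hψ : Continuous ψ) {a b c : ℝ}
    (h0 : ∀ θ ∈ Icc a b, c < ψ (θ, 0)) :
    ∃ δ : ℝ, 0 < δ ∧ ∀ θ ∈ Icc a b, ∀ t ∈ Icc (0 : ℝ) δ, c < ψ (θ, t) := by
  set K : Set (ℝ × ℝ) := (Icc a b ×ˢ Icc (0 : ℝ) 1) ∩ ψ ⁻¹' Iic c with hK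
  have hKc : IsCompact K := (isCompact_Icc.prod isCompact_Icc).inter_right (isClosed_Iic.preimage hψ)
  by_cases hne : K.Nonempty
  · obtain ⟨p, hpK, hmin⟩ := hKc.exists_isMinOn hne continuous_snd.continuousOn
    have hp2 : 0 < p.2 := by
      rcases hpK with ⟨⟨hp1, hp2⟩, hpc⟩
      rcases hp2.1.eq_or_lt with h | h
      · exfalso
        have : c < ψ (p.1, 0) := h0 p.1 hp1
        rw [h] at this
        exact absurd hpc (not_le.2 this)
      · exact h
    refine ⟨p.2 / 2, by positivity, fun θ hθ t ht => ?_⟩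
    by_contra hle
    push Not at hle
    have htK : ((θ, t) : ℝ × ℝ) ∈ K := by
      refine ⟨⟨hθ, ht.1, ?_⟩, hle⟩
      rcases hpK with ⟨⟨-, hp2'⟩, -⟩
      linarith [ht.2, hp2'.2]
    have hmin' := (isMinOn_iff.mp hmin) (θ, t) htK
    simp only at hmin'
    linarith [ht.2]
  · refine ⟨1, one_pos, fun θ hθ t ht => ?_⟩
    by_contra hle
    push Not at hle
    exact hne ⟨(θ, t), ⟨hθ, ht⟩, hle⟩

/-- **The radial margin outside `ℬ`.** For some `δ > 0`: if `θ ∈ [-π, π]` and `u(θ,e₀) < ρ ≤ u(θ,e₀) + δ` then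
`ε(ρe⃗_r(θ)) - μ > e₀`, and if `u(θ,-e₀) - δ ≤ ρ < u(θ,-e₀)` (and `ρ ≥ 0`) then `ε(ρe⃗_r(θ)) - μ < -e₀`: by
(2.8b) the radial derivative is `≥ c₁` ON `Σ(±e₀)`, hence `≥ c₁/2` within a uniform radial distance
(compactness), and the mean value theorem. [cite: BenfattoGiulianiMastropietro2003, §1.2 (2.8b) p.4 (L107–111) and §7.1 (A1.1) p.26 (L16–22)] -/
theorem DispersionHyp.exists_radial_margin (hD : DispersionHyp ε μ e₀ u) :
    ∃ δ : ℝ, 0 < δ ∧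
      (∀ θ ∈ Icc (-π) π, ∀ ρ : ℝ, u θ e₀ < ρ → ρ ≤ u θ e₀ + δ → e₀ < ε (ρ • dir θ) - μ) ∧
      (∀ θ ∈ Icc (-π) π, ∀ ρ : ℝ, u θ (-e₀) - δ ≤ ρ → ρ < u θ (-e₀) → ε (ρ • dir θ) - μ < -e₀) := by
  obtain ⟨c₁, c₂, hc₁, -, hrad⟩ := hD.radial
  have hε := hD.smooth_ε
  have heP : |(e₀ : ℝ)| ≤ e₀ := by rw [abs_of_pos hD.e₀_pos]
  have heM : |(-e₀ : ℝ)| ≤ e₀ := by rw [abs_neg, abs_of_pos hD.e₀_pos]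
  have hcont := continuous_radialSlope hε
  -- outer side
  have hψP : Continuous fun p : ℝ × ℝ => radialSlope ε p.1 (u p.1 e₀ + p.2) :=
    hcont.comp (continuous_fst.prodMk (((hD.contDiff_radius heP).continuous.comp continuous_fst).add continuous_snd))
  have h0P : ∀ θ ∈ Icc (-π) π, c₁ / 2 < (fun p : ℝ × ℝ => radialSlope ε p.1 (u p.1 e₀ + p.2)) (θ, 0) := by
    intro θ _
    simp only [add_zero]
    have := (hrad θ e₀ heP).1
    rw [← radialSlope_levelPoint] at this
    linarith
  obtain ⟨δP, hδP, HP⟩ := exists_pos_forall_lt_of_continuous hψP h0P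
  -- inner side
  have hψM : Continuous fun p : ℝ × ℝ => radialSlope ε p.1 (u p.1 (-e₀) - p.2) :=
    hcont.comp (continuous_fst.prodMk (((hD.contDiff_radius heM).continuous.comp continuous_fst).sub continuous_snd))
  have h0M : ∀ θ ∈ Icc (-π) π, c₁ / 2 < (fun p : ℝ × ℝ => radialSlope ε p.1 (u p.1 (-e₀) - p.2)) (θ, 0) := by
    intro θ _
    simp only [sub_zero]
    have := (hrad θ (-e₀) heM).1
    rw [← radialSlope_levelPoint] at this
    linarith
  obtain ⟨δM, hδM, HM⟩ := exists_pos_forall_lt_of_continuous hψM h0M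
  refine ⟨min δP δM, lt_min hδP hδM, fun θ hθ ρ h1 h2 => ?_, fun θ hθ ρ h1 h2 => ?_⟩
  · -- mean value theorem on `[u(θ,e₀), ρ]`
    have hderiv : ∀ r ∈ Icc (u θ e₀) ρ, HasDerivAt (fun r : ℝ => ε (r • dir θ)) (radialSlope ε θ r) r :=
      fun r _ => hasDerivAt_eps_radial hε θ r
    obtain ⟨ξ, hξ, hslope⟩ := exists_hasDerivAt_eq_slope (fun r : ℝ => ε (r • dir θ)) (radialSlope ε θ) h1
      (fun r hr => (hderiv r hr).continuousAt.continuousWithinAt) (fun r hr => hderiv r (Ioo_subset_Icc_self hr))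
    have hξpos : c₁ / 2 < radialSlope ε θ ξ := by
      have := HP θ hθ (ξ - u θ e₀) ⟨by linarith [hξ.1], by linarith [hξ.2, min_le_left δP δM]⟩
      simpa using this
    have hbase : ε (u θ e₀ • dir θ) = μ + e₀ := hD.level θ e₀ heP
    have hpos : 0 < (ε (ρ • dir θ) - ε (u θ e₀ • dir θ)) / (ρ - u θ e₀) := by
      rw [← hslope]; linarith
    have hnum : 0 < ε (ρ • dir θ) - ε (u θ e₀ • dir θ) := by
      have hden : 0 < ρ - u θ e₀ := by linarith
      exact (div_pos_iff_of_pos_right hden).1 hpos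
    linarith
  · -- mean value theorem on `[ρ, u(θ,-e₀)]`
    have hderiv : ∀ r ∈ Icc ρ (u θ (-e₀)), HasDerivAt (fun r : ℝ => ε (r • dir θ)) (radialSlope ε θ r) r :=
      fun r _ => hasDerivAt_eps_radial hε θ r
    obtain ⟨ξ, hξ, hslope⟩ := exists_hasDerivAt_eq_slope (fun r : ℝ => ε (r • dir θ)) (radialSlope ε θ) h2
      (fun r hr => (hderiv r hr).continuousAt.continuousWithinAt) (fun r hr => hderiv r (Ioo_subset_Icc_self hr))
    have hξpos : c₁ / 2 < radialSlope ε θ ξ := by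
      have := HM θ hθ (u θ (-e₀) - ξ) ⟨by linarith [hξ.2], by linarith [hξ.1, min_le_right δP δM]⟩
      simpa using this
    have hbase : ε (u θ (-e₀) • dir θ) = μ + -e₀ := hD.level θ (-e₀) heM
    have hpos : 0 < (ε (u θ (-e₀) • dir θ) - ε (ρ • dir θ)) / (u θ (-e₀) - ρ) := by
      rw [← hslope]; linarith
    have hnum : 0 < ε (u θ (-e₀) • dir θ) - ε (ρ • dir θ) := by
      have hden : 0 < u θ (-e₀) - ρ := by linarith
      exact (div_pos_iff_of_pos_right hden).1 hpos
    linarith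

/-! ### §3. The smooth shell bump `χ` -/

/-- **The shell bump** `χ_δ(k⃗) = S((‖k⃗‖ - u(θ(k⃗),-e₀) + δ)/δ) · S((u(θ(k⃗),e₀) + δ - ‖k⃗‖)/δ)`, `S` Mathlib's
`Real.smoothTransition`: `= 1` when `u(θ,-e₀) ≤ ‖k⃗‖ ≤ u(θ,e₀)` (i.e. on `ℬ`), `= 0` when `‖k⃗‖ ≥ u(θ,e₀) + δ` or
`‖k⃗‖ ≤ u(θ,-e₀) - δ`.  (A technical device of this proof: the smooth stand-in for the indicator of `ℬ` in F3c's
`sectorCutoff`.) [cite: BenfattoGiulianiMastropietro2003, §7.1 (A1.1) p.26 (L16–22)] -/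
def shellBump (u : ℝ → ℝ → ℝ) (e₀ δ : ℝ) (k : Fin 2 → ℝ) : ℝ :=
  Real.smoothTransition ((‖momToComplex k‖ - u (polarAngle k) (-e₀) + δ) / δ) *
    Real.smoothTransition ((u (polarAngle k) e₀ + δ - ‖momToComplex k‖) / δ)

/-- `0 ≤ χ ≤ 1`. [cite: BenfattoGiulianiMastropietro2003, §7.1 (A1.1) p.26 (L16–22)] -/
theorem shellBump_mem_Icc (u : ℝ → ℝ → ℝ) (e₀ δ : ℝ) (k : Fin 2 → ℝ) : shellBump u e₀ δ k ∈ Icc (0 : ℝ) 1 :=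
  ⟨mul_nonneg (Real.smoothTransition.nonneg _) (Real.smoothTransition.nonneg _),
    mul_le_one₀ (Real.smoothTransition.le_one _) (Real.smoothTransition.nonneg _) (Real.smoothTransition.le_one _)⟩

/-- `χ = 1` on the radial band `u(θ(k⃗),-e₀) ≤ ‖k⃗‖ ≤ u(θ(k⃗),e₀)`. [cite: BenfattoGiulianiMastropietro2003, §7.1 (A1.1) p.26 (L16–22)] -/
theorem shellBump_eq_one {u : ℝ → ℝ → ℝ} {e₀ δ : ℝ} (hδ : 0 < δ) {k : Fin 2 → ℝ}
    (h1 : u (polarAngle k) (-e₀) ≤ ‖momToComplex k‖) (h2 : ‖momToComplex k‖ ≤ u (polarAngle k) e₀) :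
    shellBump u e₀ δ k = 1 := by
  rw [shellBump, Real.smoothTransition.one_of_one_le, Real.smoothTransition.one_of_one_le, mul_one]
  · rw [le_div_iff₀ hδ]; linarith
  · rw [le_div_iff₀ hδ]; linarith

/-- `χ = 1` on `ℬ`. [cite: BenfattoGiulianiMastropietro2003, §7.1 (A1.1) p.26 (L16–22)] -/
theorem DispersionHyp.shellBump_eq_one_of_mem_shell (hD : DispersionHyp ε μ e₀ u) {δ : ℝ} (hδ : 0 < δ)
    {k : Fin 2 → ℝ} (hk : k ∈ shell u e₀) : shellBump u e₀ δ k = 1 :=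
  shellBump_eq_one hδ (hD.radius_le_norm_of_mem_shell hk).1 (hD.radius_le_norm_of_mem_shell hk).2

/-- If `χ(k⃗) ≠ 0` then `u(θ(k⃗),-e₀) - δ < ‖k⃗‖ < u(θ(k⃗),e₀) + δ`. [cite: BenfattoGiulianiMastropietro2003, §7.1 (A1.1) p.26 (L16–22)] -/
theorem radius_lt_of_shellBump_ne_zero {u : ℝ → ℝ → ℝ} {e₀ δ : ℝ} (hδ : 0 < δ) {k : Fin 2 → ℝ}
    (h : shellBump u e₀ δ k ≠ 0) :
    u (polarAngle k) (-e₀) - δ < ‖momToComplex k‖ ∧ ‖momToComplex k‖ < u (polarAngle k) e₀ + δ := by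
  rw [shellBump] at h
  have h1 := left_ne_zero_of_mul h
  have h2 := right_ne_zero_of_mul h
  constructor
  · by_contra hle
    push Not at hle
    exact h1 (Real.smoothTransition.zero_of_nonpos (div_nonpos_of_nonpos_of_nonneg (by linarith) hδ.le))
  · by_contra hle
    push Not at hle
    exact h2 (Real.smoothTransition.zero_of_nonpos (div_nonpos_of_nonpos_of_nonneg (by linarith) hδ.le))

/-- `χ` vanishes near the origin: if `δ < u(θ,-e₀)` uniformly (say `δ ≤ c/2` with `u ≥ c`), then `χ(k⃗) = 0` for
`‖k⃗‖ ≤ c/2`. [cite: BenfattoGiulianiMastropietro2003, §7.1 (A1.1) p.26 (L16–22)] -/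
theorem shellBump_eq_zero_of_norm_le {u : ℝ → ℝ → ℝ} {e₀ δ c : ℝ} (hδ : 0 < δ) (hδc : δ ≤ c / 2)
    (hcu : ∀ θ, c ≤ u θ (-e₀)) {k : Fin 2 → ℝ} (hk : ‖momToComplex k‖ < c / 2) : shellBump u e₀ δ k = 0 := by
  rw [shellBump, Real.smoothTransition.zero_of_nonpos, zero_mul]
  refine div_nonpos_of_nonpos_of_nonneg ?_ hδ.le
  linarith [hcu (polarAngle k)]

/-- **`χ` is smooth** (given `0 < δ ≤ c/2`, `u(·,±e₀) ≥ c` smooth and `2π`-periodic): away from the origin it is a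
composition of smooth functions of `‖k⃗‖` and of the `2π`-periodic smooth `u(·,±e₀)` with the polar angle
(`ContDiff.contDiffAt_comp_arg`); near the origin it vanishes identically. [cite: BenfattoGiulianiMastropietro2003, §7.1 (A1.1) p.26 (L16–22)] -/
theorem DispersionHyp.contDiff_shellBump (hD : DispersionHyp ε μ e₀ u) {δ c : ℝ} (hδ : 0 < δ) (hc : 0 < c)
    (hδc : δ ≤ c / 2) (hcu : ∀ θ e, |e| ≤ e₀ → c ≤ u θ e) : ContDiff ℝ ∞ (shellBump u e₀ δ) := by
  have heP : |(e₀ : ℝ)| ≤ e₀ := by rw [abs_of_pos hD.e₀_pos]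
  have heM : |(-e₀ : ℝ)| ≤ e₀ := by rw [abs_neg, abs_of_pos hD.e₀_pos]
  refine contDiff_iff_contDiffAt.2 fun k => ?_
  by_cases hk : ‖momToComplex k‖ < c / 2
  · -- near such `k` the bump vanishes identically
    have hev : shellBump u e₀ δ =ᶠ[𝓝 k] fun _ => 0 := by
      have hopen : IsOpen {q : Fin 2 → ℝ | ‖momToComplex q‖ < c / 2} :=
        isOpen_lt (continuous_norm.comp (contDiff_momToComplex (m := 0)).continuous) continuous_const
      filter_upwards [hopen.mem_nhds hk] with q hq
      exact shellBump_eq_zero_of_norm_le hδ hδc (fun θ => hcu θ (-e₀) heM) hq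
    exact (contDiffAt_const (c := (0 : ℝ))).congr_of_eventuallyEq hev
  · have hz : momToComplex k ≠ 0 := by
      intro h0; rw [h0, norm_zero] at hk; exact hk (by positivity)
    have hnorm : ContDiffAt ℝ ∞ (fun q : Fin 2 → ℝ => ‖momToComplex q‖) k :=
      (contDiffAt_norm ℝ hz).comp k contDiff_momToComplex.contDiffAt
    have huP : ContDiffAt ℝ ∞ (fun q : Fin 2 → ℝ => u (polarAngle q) e₀) k :=
      ((hD.contDiff_radius heP).contDiffAt_comp_arg (hD.periodic_u e₀) hz).comp k contDiff_momToComplex.contDiffAt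
    have huM : ContDiffAt ℝ ∞ (fun q : Fin 2 → ℝ => u (polarAngle q) (-e₀)) k :=
      ((hD.contDiff_radius heM).contDiffAt_comp_arg (hD.periodic_u (-e₀)) hz).comp k contDiff_momToComplex.contDiffAt
    have hS : ContDiff ℝ ∞ Real.smoothTransition := Real.smoothTransition.contDiff
    exact (hS.contDiffAt.comp k (((hnorm.sub huM).add contDiffAt_const).div_const δ)).mul
      (hS.contDiffAt.comp k (((huP.add contDiffAt_const).sub hnorm).div_const δ))

/-- **The shell bump does its job.**  There are `δ, r > 0` such that `χ = shellBump u e₀ δ` is smooth, `χ = 1` on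
`ℬ`, `χ(k⃗) ≠ 0 ⟹ ‖k⃗‖ ≥ 2r`, and `χ(k⃗) ≠ 0`, `k⃗ ∉ ℬ ⟹ |ε(k⃗) - μ| > e₀` (§2's radial margin) — so
`𝟙_ℬ · f_h = χ · f_h` for every single-scale cutoff supported in `|ε - μ| < e₀`. [cite: BenfattoGiulianiMastropietro2003, §7.1 (A1.1) p.26 (L16–22) and §2.1 (3.4) p.6 (L86–92)] -/
theorem DispersionHyp.exists_shellBump (hD : DispersionHyp ε μ e₀ u) :
    ∃ δ r : ℝ, 0 < δ ∧ 0 < r ∧ ContDiff ℝ ∞ (shellBump u e₀ δ) ∧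
      (∀ k ∈ shell u e₀, shellBump u e₀ δ k = 1) ∧
      (∀ k, shellBump u e₀ δ k ≠ 0 → 2 * r ≤ ‖momToComplex k‖) ∧
      (∀ k, shellBump u e₀ δ k ≠ 0 → k ∉ shell u e₀ → e₀ < |ε k - μ|) := by
  obtain ⟨c, hc, hcu⟩ := hD.u_pos
  obtain ⟨δ₁, hδ₁, Hout, Hin⟩ := hD.exists_radial_margin
  have heP : |(e₀ : ℝ)| ≤ e₀ := by rw [abs_of_pos hD.e₀_pos]
  have heM : |(-e₀ : ℝ)| ≤ e₀ := by rw [abs_neg, abs_of_pos hD.e₀_pos]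
  set δ : ℝ := min δ₁ (c / 2) with hδdef
  have hδ : 0 < δ := lt_min hδ₁ (by positivity)
  have hδc : δ ≤ c / 2 := min_le_right _ _
  have hδ1 : δ ≤ δ₁ := min_le_left _ _
  refine ⟨δ, c / 4, hδ, by positivity, hD.contDiff_shellBump hδ hc hδc hcu,
    fun k hk => hD.shellBump_eq_one_of_mem_shell hδ hk, fun k hk => ?_, fun k hk hks => ?_⟩
  · by_contra hlt
    push Not at hlt
    exact hk (shellBump_eq_zero_of_norm_le hδ hδc (fun θ => hcu θ (-e₀) heM) (by linarith))
  · obtain ⟨hlo, hhi⟩ := radius_lt_of_shellBump_ne_zero hδ hk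
    set ρ : ℝ := ‖momToComplex k‖ with hρ
    set θ : ℝ := polarAngle k with hθ
    have hθmem : θ ∈ Icc (-π) π := ⟨(Complex.neg_pi_lt_arg _).le, Complex.arg_le_pi _⟩
    have hkpol : k = ρ • dir θ := polar_repr k
    -- `k ∉ ℬ` forces `ρ` off the band `[u(θ,-e₀), u(θ,e₀)]`
    have hoff : ρ < u θ (-e₀) ∨ u θ e₀ < ρ := by
      by_contra h
      push Not at h
      exact hks (hD.mem_shell_of_radius_le_norm h.1 h.2)
    have he0 := hD.e₀_pos
    rcases hoff with h | h
    · have := Hin θ hθmem ρ (by linarith) h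
      rw [hkpol, abs_sub_comm, abs_of_pos (by linarith)]
      linarith
    · have := Hout θ hθmem ρ h (by linarith)
      rw [hkpol, abs_of_pos (by linarith)]
      linarith

/-! ### §4. The anisotropic chart down to `s = 0` -/

/-- **The chart point** `k⃗(θ₀,a,b;s) = p⃗_F(θ₀) + s²a n⃗(θ₀) + s b τ⃗(θ₀)` ((3.21a) with `k'₁ = s²a`, `k'₂ = sb`,
`s = γ^{h/2} = 2^{-n}`; the tree's `sectorChartPoint` for the Hubbard frame). [cite: BenfattoGiulianiMastropietro2003, §2.3 (3.21a) p.8 (L36–41)] -/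
def chartPt (u : ℝ → ℝ → ℝ) (x : ℝ × ℝ × ℝ) (s : ℝ) : Fin 2 → ℝ :=
  fermiPoint u x.1 + (s ^ 2 * x.2.1) • unitNormal u x.1 0 + (s * x.2.2) • unitTangent u x.1 0

/-- Components of the chart point. [cite: BenfattoGiulianiMastropietro2003, §2.3 (3.21a) p.8 (L36–41)] -/
theorem chartPt_apply (u : ℝ → ℝ → ℝ) (x : ℝ × ℝ × ℝ) (s : ℝ) (i : Fin 2) :
    chartPt u x s i = fermiPoint u x.1 i + s ^ 2 * x.2.1 * unitNormal u x.1 0 i + s * x.2.2 * unitTangent u x.1 0 i := by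
  simp [chartPt, Pi.add_apply, Pi.smul_apply, smul_eq_mul]

/-- At `s = 0` the chart point is the Fermi point. [cite: BenfattoGiulianiMastropietro2003, §2.3 (3.21a) p.8 (L36–41)] -/
@[simp] theorem chartPt_zero (u : ℝ → ℝ → ℝ) (x : ℝ × ℝ × ℝ) : chartPt u x 0 = fermiPoint u x.1 := by
  ext i; simp [chartPt_apply]

/-- `k⃗ - p⃗_F(θ₀) = s²a n⃗ + s b τ⃗`. [cite: BenfattoGiulianiMastropietro2003, §2.3 (3.21a) p.8 (L36–41)] -/
theorem chartPt_sub_fermiPoint (u : ℝ → ℝ → ℝ) (x : ℝ × ℝ × ℝ) (s : ℝ) :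
    chartPt u x s - fermiPoint u x.1 = (s ^ 2 * x.2.1) • unitNormal u x.1 0 + (s * x.2.2) • unitTangent u x.1 0 := by
  rw [chartPt]; abel

/-- **The chart point is smooth in `(θ₀, a, b, s)`.** [cite: BenfattoGiulianiMastropietro2003, §2.3 (3.21a) p.8 (L36–41)] -/
theorem DispersionHyp.contDiff_uncurry_chartPt (hD : DispersionHyp ε μ e₀ u) :
    ContDiff ℝ ∞ (uncurry (chartPt u)) := by
  have hθ : ContDiff ℝ ∞ fun p : (ℝ × ℝ × ℝ) × ℝ => p.1.1 := contDiff_fst.comp contDiff_fst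
  have ha : ContDiff ℝ ∞ fun p : (ℝ × ℝ × ℝ) × ℝ => p.1.2.1 := contDiff_fst.comp (contDiff_snd.comp contDiff_fst)
  have hb : ContDiff ℝ ∞ fun p : (ℝ × ℝ × ℝ) × ℝ => p.1.2.2 := contDiff_snd.comp (contDiff_snd.comp contDiff_fst)
  have hs : ContDiff ℝ ∞ fun p : (ℝ × ℝ × ℝ) × ℝ => p.2 := contDiff_snd
  refine contDiff_pi.2 fun i => ?_
  have hp := (hD.contDiff_fermiPoint_apply i).comp hθ
  have hn := (hD.contDiff_unitNormal_apply i).comp hθ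
  have ht := (hD.contDiff_unitTangent_apply i).comp hθ
  have key : (fun p : (ℝ × ℝ × ℝ) × ℝ => uncurry (chartPt u) p i) = fun p =>
      fermiPoint u p.1.1 i + p.2 ^ 2 * p.1.2.1 * unitNormal u p.1.1 0 i + p.2 * p.1.2.2 * unitTangent u p.1.1 0 i := by
    funext p; simp [uncurry, chartPt_apply]
  rw [key]
  exact (hp.add (((hs.pow 2).mul ha).mul hn)).add ((hs.mul hb).mul ht)

/-- `ε(k⃗(θ₀,a,b;s)) - μ` as a function of `((θ₀,a,b), s)`. [cite: BenfattoGiulianiMastropietro2003, §2.3 (3.20c) p.8 (L43–48)] -/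
def epsFun (ε : (Fin 2 → ℝ) → ℝ) (u : ℝ → ℝ → ℝ) (μ : ℝ) : (ℝ × ℝ × ℝ) × ℝ → ℝ :=
  fun p => ε (chartPt u p.1 p.2) - μ

/-- **The rescaled dispersion** `Ẽ = Q(Q(epsFun))`: `ε(k⃗) - μ = s² Ẽ` with `Ẽ` smooth down to `s = 0` — the
`γ^{-h}(ε(k⃗) - μ) = O(1)` on a sector. [cite: BenfattoGiulianiMastropietro2003, §7.2 p.27 (L28–52)] -/
def rescaledEps (ε : (Fin 2 → ℝ) → ℝ) (u : ℝ → ℝ → ℝ) (μ : ℝ) : (ℝ × ℝ × ℝ) × ℝ → ℝ :=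
  slopeQuot (slopeQuot (epsFun ε u μ))

/-- `epsFun` is smooth. [cite: BenfattoGiulianiMastropietro2003, §7.2 p.27 (L28–52)] -/
theorem DispersionHyp.contDiff_epsFun (hD : DispersionHyp ε μ e₀ u) : ContDiff ℝ ∞ (epsFun ε u μ) :=
  (hD.smooth_ε.comp hD.contDiff_uncurry_chartPt).sub contDiff_const

/-- `epsFun (x, 0) = 0`: `p⃗_F(θ₀)` lies on the Fermi curve. [cite: BenfattoGiulianiMastropietro2003, §1.2 item 1 p.4 (L97–105)] -/
theorem DispersionHyp.epsFun_zero (hD : DispersionHyp ε μ e₀ u) (x : ℝ × ℝ × ℝ) : epsFun ε u μ (x, 0) = 0 := by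
  have he : |(0 : ℝ)| ≤ e₀ := by rw [abs_zero]; exact hD.e₀_pos.le
  simp only [epsFun, chartPt_zero, fermiPoint]
  rw [hD.level x.1 0 he]; ring

/-- The slice `s ↦ epsFun (x, s)` has derivative `0` at `s = 0` (the tangency of §1). [cite: BenfattoGiulianiMastropietro2003, §2.3 (3.21) p.8 (L27–32)] -/
theorem DispersionHyp.hasDerivAt_epsFun_slice_zero (hD : DispersionHyp ε μ e₀ u) (x : ℝ × ℝ × ℝ) :
    HasDerivAt (fun s : ℝ => epsFun ε u μ (x, s)) 0 0 := by
  obtain ⟨θ₀, a, b⟩ := x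
  have hchart : HasDerivAt (fun s : ℝ => chartPt u (θ₀, a, b) s) (b • unitTangent u θ₀ 0) 0 := by
    have h1 : HasDerivAt (fun s : ℝ => (s ^ 2 * a) • unitNormal u θ₀ 0) ((2 * (0 : ℝ) ^ 1 * a) • unitNormal u θ₀ 0) 0 :=
      ((hasDerivAt_pow 2 (0 : ℝ)).mul_const a).smul_const _
    have h2 : HasDerivAt (fun s : ℝ => (s * b) • unitTangent u θ₀ 0) (((1 : ℝ) * b) • unitTangent u θ₀ 0) 0 :=
      ((hasDerivAt_id (0 : ℝ)).mul_const b).smul_const _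
    have h := (h1.add h2).const_add (fermiPoint u θ₀)
    simp only [pow_one, mul_zero, zero_mul, zero_smul, one_mul, zero_add] at h
    have key : (fun s : ℝ => chartPt u (θ₀, a, b) s) = fun s =>
        fermiPoint u θ₀ + ((s ^ 2 * a) • unitNormal u θ₀ 0 + (s * b) • unitTangent u θ₀ 0) := by
      funext s; rw [chartPt]; simp only; abel
    rw [key]; exact h
  have hε : DifferentiableAt ℝ ε (chartPt u (θ₀, a, b) 0) := (hD.smooth_ε.differentiable (by simp)).differentiableAt
  have hcomp := hε.hasFDerivAt.comp_hasDerivAt (0 : ℝ) hchart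
  rw [chartPt_zero, map_smul, smul_eq_mul] at hcomp
  simp only at hcomp
  rw [hD.fderiv_fermiPoint_unitTangent θ₀, mul_zero] at hcomp
  exact hcomp.sub_const μ

/-- Hence `∂_s epsFun (x, 0) = 0`. [cite: BenfattoGiulianiMastropietro2003, §7.2 p.27 (L28–52)] -/
theorem DispersionHyp.fderiv_epsFun_zero (hD : DispersionHyp ε μ e₀ u) (x : ℝ × ℝ × ℝ) :
    fderiv ℝ (epsFun ε u μ) (x, 0) (0, 1) = 0 := by
  have hdiff : DifferentiableAt ℝ (epsFun ε u μ) (x, 0) :=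
    (hD.contDiff_epsFun.differentiable (by simp)).differentiableAt
  have hline : HasDerivAt (fun s : ℝ => ((x, s) : (ℝ × ℝ × ℝ) × ℝ)) ((0 : ℝ × ℝ × ℝ), (1 : ℝ)) 0 :=
    (hasDerivAt_const (0 : ℝ) x).prodMk (hasDerivAt_id 0)
  have hcomp := hdiff.hasFDerivAt.comp_hasDerivAt (0 : ℝ) hline
  exact hcomp.unique (hD.hasDerivAt_epsFun_slice_zero x)

/-- `Ẽ` is smooth. [cite: BenfattoGiulianiMastropietro2003, §7.2 p.27 (L28–52)] -/
theorem DispersionHyp.contDiff_rescaledEps (hD : DispersionHyp ε μ e₀ u) : ContDiff ℝ ∞ (rescaledEps ε u μ) :=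
  contDiff_slopeQuot_infty (contDiff_slopeQuot_infty hD.contDiff_epsFun)

/-- **`ε(k⃗) - μ = s² Ẽ`**: second-order vanishing at `s = 0`. [cite: BenfattoGiulianiMastropietro2003, §7.2 p.27 (L28–52)] -/
theorem DispersionHyp.epsFun_eq_sq_mul_rescaledEps (hD : DispersionHyp ε μ e₀ u) (x : ℝ × ℝ × ℝ) (s : ℝ) :
    epsFun ε u μ (x, s) = s ^ 2 * rescaledEps ε u μ (x, s) := by
  have h := eq_add_add_sq_smul_slopeQuot₂ (hD.contDiff_epsFun.of_le (by norm_cast)) x s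
  rw [hD.epsFun_zero, hD.fderiv_epsFun_zero, smul_zero, zero_add, zero_add, smul_eq_mul] at h
  exact h

/-- `u = (k₁ + ik₂) e^{-iθ₀}` at the chart point (the tree's `sectorUFun` for the Hubbard frame). [cite: BenfattoGiulianiMastropietro2003, §7.2 p.27 (L28–52)] -/
def uFun (u : ℝ → ℝ → ℝ) (x : ℝ × ℝ × ℝ) (s : ℝ) : ℂ := momToComplex (chartPt u x s) * exp (-((x.1 : ℝ) * I))

/-- **The truncated relative angle** `angFun = truncArg r cos(7π/8) cos(15π/16) ∘ u` (globally smooth;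
`= arg u`, the angle of `k⃗` relative to `θ₀`, on `{‖u‖ ≥ r, |arg u| ≤ 7π/8}`). [cite: BenfattoGiulianiMastropietro2003, §7.2 p.27 (L28–52)] -/
def angFun (u : ℝ → ℝ → ℝ) (r : ℝ) : (ℝ × ℝ × ℝ) × ℝ → ℝ := fun p =>
  truncArg r (Real.cos (7 * π / 8)) (Real.cos (15 * π / 16)) (uFun u p.1 p.2)

/-- **The rescaled relative angle** `Ã = Q(angFun)`: `angFun = s Ã`, smooth down to `s = 0` — the
`γ^{-h/2}(θ(k⃗) - θ_{h,ω}) = O(1)` on a sector. [cite: BenfattoGiulianiMastropietro2003, §7.2 p.27 (L28–52)] -/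
def rescaledAng (u : ℝ → ℝ → ℝ) (r : ℝ) : (ℝ × ℝ × ℝ) × ℝ → ℝ := slopeQuot (angFun u r)

/-- `u` depends smoothly on `(θ₀, a, b, s)`. [cite: BenfattoGiulianiMastropietro2003, §7.2 p.27 (L28–52)] -/
theorem DispersionHyp.contDiff_uncurry_uFun (hD : DispersionHyp ε μ e₀ u) : ContDiff ℝ ∞ (uncurry (uFun u)) := by
  have h1 : ContDiff ℝ ∞ fun p : (ℝ × ℝ × ℝ) × ℝ => momToComplex (chartPt u p.1 p.2) :=
    contDiff_momToComplex.comp hD.contDiff_uncurry_chartPt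
  have h2 : ContDiff ℝ ∞ fun p : (ℝ × ℝ × ℝ) × ℝ => exp (-((p.1.1 : ℝ) * I)) := by
    refine (Complex.contDiff_exp (𝕜 := ℝ)).comp ?_
    exact ((Complex.ofRealCLM.contDiff.comp (contDiff_fst.comp contDiff_fst)).mul contDiff_const).neg
  exact h1.mul h2

/-- `angFun` is smooth (for `r > 0`). [cite: BenfattoGiulianiMastropietro2003, §7.2 p.27 (L28–52)] -/
theorem DispersionHyp.contDiff_angFun (hD : DispersionHyp ε μ e₀ u) {r : ℝ} (hr : 0 < r) :
    ContDiff ℝ ∞ (angFun u r) :=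
  (contDiff_truncArg hr cos_fifteen_lt_cos_seven neg_one_lt_cos_fifteen).comp hD.contDiff_uncurry_uFun

/-- **At `s = 0`, `u = u(θ₀, 0) > 0`** (a positive real number). [cite: BenfattoGiulianiMastropietro2003, §7.2 p.27 (L28–52)] -/
theorem uFun_zero (u : ℝ → ℝ → ℝ) (x : ℝ × ℝ × ℝ) : uFun u x 0 = (u x.1 0 : ℂ) := by
  rw [uFun, chartPt_zero, fermiPoint, levelPoint, momToComplex_smul_dir, mul_assoc, ← Complex.exp_add,
    show (x.1 : ℂ) * I + -((x.1 : ℂ) * I) = 0 by ring, Complex.exp_zero, mul_one]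

/-- Hence `angFun (x, 0) = 0`. [cite: BenfattoGiulianiMastropietro2003, §7.2 p.27 (L28–52)] -/
theorem DispersionHyp.angFun_zero (hD : DispersionHyp ε μ e₀ u) (r : ℝ) (x : ℝ × ℝ × ℝ) : angFun u r (x, 0) = 0 := by
  have he : |(0 : ℝ)| ≤ e₀ := by rw [abs_zero]; exact hD.e₀_pos.le
  simp only [angFun, uFun_zero, truncArg, Complex.arg_ofReal_of_nonneg (hD.radius_pos x.1 he).le, mul_zero]

/-- `Ã` is smooth (for `r > 0`). [cite: BenfattoGiulianiMastropietro2003, §7.2 p.27 (L28–52)] -/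
theorem DispersionHyp.contDiff_rescaledAng (hD : DispersionHyp ε μ e₀ u) {r : ℝ} (hr : 0 < r) :
    ContDiff ℝ ∞ (rescaledAng u r) :=
  contDiff_slopeQuot_infty (hD.contDiff_angFun hr)

/-- **`angFun = s Ã`**: first-order vanishing at `s = 0`. [cite: BenfattoGiulianiMastropietro2003, §7.2 p.27 (L28–52)] -/
theorem DispersionHyp.angFun_eq_mul_rescaledAng (hD : DispersionHyp ε μ e₀ u) {r : ℝ} (hr : 0 < r)
    (x : ℝ × ℝ × ℝ) (s : ℝ) : angFun u r (x, s) = s * rescaledAng u r (x, s) := by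
  have h := eq_add_smul_slopeQuot (hD.contDiff_angFun hr) (by simp) x s
  rw [hD.angFun_zero, zero_add, smul_eq_mul] at h
  exact h

/-- `‖u‖ = ‖k⃗‖`. [cite: BenfattoGiulianiMastropietro2003, §7.2 p.27 (L28–52)] -/
theorem norm_uFun (u : ℝ → ℝ → ℝ) (x : ℝ × ℝ × ℝ) (s : ℝ) : ‖uFun u x s‖ = ‖momToComplex (chartPt u x s)‖ := by
  rw [uFun, norm_mul, show -((x.1 : ℂ) * I) = ((-x.1 : ℝ) : ℂ) * I by push_cast; ring,
    Complex.norm_exp_ofReal_mul_I, mul_one]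

/-- `arg u` is the tree's relative angle `sectorRelAngle θ₀` of the chart point. [cite: BenfattoGiulianiMastropietro2003, §7.2 p.27 (L28–52)] -/
theorem arg_uFun (u : ℝ → ℝ → ℝ) (x : ℝ × ℝ × ℝ) (s : ℝ) : arg (uFun u x s) = sectorRelAngle x.1 (chartPt u x s) := rfl

/-- **Frame coordinates of the chart point**: `(k⃗ - p⃗_F)·n⃗ = s²a`. [cite: BenfattoGiulianiMastropietro2003, §2.3 (3.21a) p.8 (L36–41)] -/
theorem DispersionHyp.chartPt_sub_dot_unitNormal (hD : DispersionHyp ε μ e₀ u) (x : ℝ × ℝ × ℝ) (s : ℝ) :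
    ∑ i : Fin 2, (chartPt u x s i - fermiPoint u x.1 i) * unitNormal u x.1 0 i = s ^ 2 * x.2.1 := by
  have he : |(0 : ℝ)| ≤ e₀ := by rw [abs_zero]; exact hD.e₀_pos.le
  have hn := hD.unitNormal_normSq x.1 he
  have ht := unitNormal_dot_unitTangent u x.1 0
  simp only [Fin.sum_univ_two, chartPt_apply]
  linear_combination (s ^ 2 * x.2.1) * hn + (s * x.2.2) * ht

/-- **Frame coordinates of the chart point**: `(k⃗ - p⃗_F)·τ⃗ = s b`. [cite: BenfattoGiulianiMastropietro2003, §2.3 (3.21a) p.8 (L36–41)] -/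
theorem DispersionHyp.chartPt_sub_dot_unitTangent (hD : DispersionHyp ε μ e₀ u) (x : ℝ × ℝ × ℝ) (s : ℝ) :
    ∑ i : Fin 2, (chartPt u x s i - fermiPoint u x.1 i) * unitTangent u x.1 0 i = s * x.2.2 := by
  have he : |(0 : ℝ)| ≤ e₀ := by rw [abs_zero]; exact hD.e₀_pos.le
  have hτ := hD.unitTangent_normSq x.1 he
  have ht := unitNormal_dot_unitTangent u x.1 0
  simp only [Fin.sum_univ_two, chartPt_apply]
  linear_combination (s * x.2.2) * hτ + (s ^ 2 * x.2.1) * ht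

/-- **Every momentum has frame coordinates** (the frame is an orthonormal basis): with `k₁ = (k⃗ - p⃗_F)·n⃗`,
`k₂ = (k⃗ - p⃗_F)·τ⃗` one has `k⃗ = p⃗_F(θ₀) + k₁ n⃗ + k₂ τ⃗`. [cite: BenfattoGiulianiMastropietro2003, §2.3 (3.21a) p.8 (L36–41)] -/
theorem DispersionHyp.eq_frame (hD : DispersionHyp ε μ e₀ u) (θ₀ : ℝ) (k : Fin 2 → ℝ) :
    k = fermiPoint u θ₀ + (∑ i : Fin 2, (k i - fermiPoint u θ₀ i) * unitNormal u θ₀ 0 i) • unitNormal u θ₀ 0 +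
      (∑ i : Fin 2, (k i - fermiPoint u θ₀ i) * unitTangent u θ₀ 0 i) • unitTangent u θ₀ 0 := by
  have he : |(0 : ℝ)| ≤ e₀ := by rw [abs_zero]; exact hD.e₀_pos.le
  have hn := hD.unitNormal_normSq θ₀ he
  ext i
  fin_cases i
  · simp only [Fin.zero_eta, Fin.isValue, Pi.add_apply, Pi.smul_apply, smul_eq_mul, Fin.sum_univ_two,
      unitTangent_apply_zero_eq, unitTangent_apply_one_eq]
    linear_combination (fermiPoint u θ₀ 0 - k 0) * hn
  · simp only [Fin.mk_one, Fin.isValue, Pi.add_apply, Pi.smul_apply, smul_eq_mul, Fin.sum_univ_two,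
      unitTangent_apply_zero_eq, unitTangent_apply_one_eq]
    linear_combination (fermiPoint u θ₀ 1 - k 1) * hn

/-- The chart at `s ≠ 0` reaches every momentum: `k⃗ = chartPt (θ₀, k₁/s², k₂/s) s`. [cite: BenfattoGiulianiMastropietro2003, §2.3 (3.21a) p.8 (L36–41)] -/
theorem DispersionHyp.eq_chartPt_of_frame (hD : DispersionHyp ε μ e₀ u) (θ₀ : ℝ) {s : ℝ} (hs : s ≠ 0)
    (k : Fin 2 → ℝ) :
    k = chartPt u (θ₀, (∑ i : Fin 2, (k i - fermiPoint u θ₀ i) * unitNormal u θ₀ 0 i) / s ^ 2,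
      (∑ i : Fin 2, (k i - fermiPoint u θ₀ i) * unitTangent u θ₀ 0 i) / s) s := by
  rw [chartPt]
  simp only
  rw [mul_div_cancel₀ _ (pow_ne_zero 2 hs), mul_div_cancel₀ _ hs]
  exact hD.eq_frame θ₀ k

end BGM2003

end Literature.MathematicalPhysics.QuantumLattice.FermiRG

end
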